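import Literature.NumberTheory.EllipticCurves.IwasawaTwistModPkTower
import Literature.NumberTheory.GaloisRepresentations.ContinuousCohomologyConnecting
import HarnessLib

/-!
# The residual image of the connecting classes of `0 → W₁ → W₂ → W₁ → 0` on the `T^{m-1}`-torsion invariants is the
# connecting image of the TOP GRADED PIECE `0 → T̄ → W₁ → W₁/T^{m-1} → 0` (theorems only)

`Proofs` file (theorems only; no definition, no named fact, no instance, no `sorry`).  One-place cocycle computation
behind Howard's hypothesis **H.5(b)** («the condition `F` propagated to `T̄` is stable under `G_ℚ`», B. Howard,
Compositio Math. 140 (2004), §1.3, arXiv:1202.6340 p. 7 L96–97) for the Eisenstein specialisation at the places of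
`S` (cell `pub/bsd-print-x9`, memo `HOME/x9-p1-w3/H5B-AT-S-PLAN-w3g5.md`, step (L2); companion of
`EllipticCurves/TowerLiftableConnectingProofs`, step (L1)).

ABSTRACT SETTING (any field `F`, `Γ = Γ_F`; all maps continuous `Γ`-equivariant maps of discrete modules):
two short exact rows

  `Σ  : 0 → W₁ →(ι) W₂ →(r) W₁ → 0`     (the first two `p`-adic levels: `ι = ×p`, `r` the reduction),
  `Σ̄ : 0 → T̄ →(j) W₁ →(q) Q → 0`       (the top graded piece: `j = ×T^{m-1}` after `T̄ = W₁/T W₁`, `Q = W₁/T^{m-1}W₁`),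

a surjection `π : W₁ ↠ T̄` (the residual presentation), endomorphisms `T₁`, `θ₁` of `W₁` and `T₂`, `θ₂` of `W₂`
(multiplication by `T` and by `T^{m-1}`) subject to the element identities of the Eisenstein levels
`W_j = E[p^j] ⊗ Λ/(T^m + p, p^j)`:
`r ∘ T₂ = T₁ ∘ r`, `ι ∘ θ₁ = θ₂ ∘ ι`, `θ₂ ∘ T₂ = −ι ∘ r` (`T^m = −p`), `j ∘ π = θ₁`, `π ∘ T₁ = 0`, `T₁ ∘ j = 0`,
`ker T₁ ⊆ range j`, `ker θ₁ ⊆ range T₁`.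

RESULTS:
* §1 `isSES_ofHom` — the rows as the tree's `IsSES`.
* §2 `smul_mem_invariants_of_apply_mem` / `exists_eq_smul_of_mem_invariants` — the invariants `w` of `W₁` with
  `θ₁ w = 0` are exactly the `T₁ w'` with `q w'` invariant in `Q`.
* §3 **`map_δ₀_smul_eq_neg_δ₀`** — for such `w'`:  `H¹(π) (δ₀^Σ (T₁ w')) = − δ₀^Σ̄ (q w')` in `H¹(F, T̄)` (the
  cocycles agree: `π (ι⁻¹(g w̃ − w̃)) = − j⁻¹(g w' − w')` for the lift `w̃ = T₂ w̃'` of `T₁ w'`).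
* §4 **`image_map_δ₀_eq_range_δ₀`** — hence the `H¹(π)`-image of `{δ₀^Σ w | w ∈ H⁰(F, W₁), θ₁ w = 0}` is the
  range of `δ₀^Σ̄` on `H⁰(F, Q)`: the residual image of the liftable classes (step (L1)) is computed on the CHAR-`p`
  row `Σ̄`, which carries the `G_ℚ`-structure `τ ⊗ ι` (step (L3)).

Seat `bsd-line-x9-p1-w3` g5.  No summit statement is proved; BSD is not proved by any of this.

References: [Howard2004HeegnerKolyvagin] §1.3 H.5(b), §1.6, §2.2 (arXiv:1202.6340 p. 7, p. 12); [SerreGaloisCohomology1997]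
I §2.2 (connecting homomorphism, cocycle formula); [NeukirchSchmidtWingberg2008] (1.3.2).
-/

noncomputable section

open CategoryTheory
open scoped ContRepresentation

universe u

namespace Literature.NumberTheory.GaloisRepresentations

namespace DiscreteGaloisModule

variable {F : Type u} [Field F]
variable {N : Type u} [AddCommGroup N] [TopologicalSpace N] [DiscreteTopology N]
variable {M₁ : Type u} [AddCommGroup M₁] [TopologicalSpace M₁] [DiscreteTopology M₁]
variable {M₂ : Type u} [AddCommGroup M₂] [TopologicalSpace M₂] [DiscreteTopology M₂]
variable {MQ : Type u} [AddCommGroup MQ] [TopologicalSpace MQ] [DiscreteTopology MQ]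
variable {ρN : DiscreteGaloisModule F N} {ρ₁ : DiscreteGaloisModule F M₁} {ρ₂ : DiscreteGaloisModule F M₂}
  {ρQ : DiscreteGaloisModule F MQ}

/-! ## §1 Rows of equivariant maps as short exact sequences -/

/-- Two continuous equivariant maps `a : X → Y`, `b : Y → Z` with `a` injective, `b` surjective and
`ker b = range a` form a short exact sequence of discrete `Γ_F`-modules (tree `IsSES`).
[cite: SerreGaloisCohomology1997, Ch. I §2.2] -/
theorem isSES_ofHom {X Y Z : Type u} [AddCommGroup X] [TopologicalSpace X] [DiscreteTopology X]
    [AddCommGroup Y] [TopologicalSpace Y] [DiscreteTopology Y] [AddCommGroup Z] [TopologicalSpace Z]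
    [DiscreteTopology Z] {ρX : DiscreteGaloisModule F X} {ρY : DiscreteGaloisModule F Y} {ρZ : DiscreteGaloisModule F Z}
    (a : ρX.toContRepresentation →ⁱL ρY.toContRepresentation) (b : ρY.toContRepresentation →ⁱL ρZ.toContRepresentation)
    (ha : Function.Injective a) (hb : Function.Surjective b) (hab : ∀ y, b y = 0 ↔ ∃ x, a x = y) :
    IsSES (TopRep.ofHom ⟨a.toContinuousLinearMap, a.isIntertwining'⟩ : ρX.toTopRep ⟶ ρY.toTopRep)
      (TopRep.ofHom ⟨b.toContinuousLinearMap, b.isIntertwining'⟩ : ρY.toTopRep ⟶ ρZ.toTopRep) where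
  comp_eq_zero := by
    ext x
    exact (hab _).mpr ⟨x, rfl⟩
  injective := ha
  exact_mid y hy := (hab y).mp hy
  surjective := hb

/-- Pointwise equivariance of a continuous intertwining map. [cite: SerreGaloisCohomology1997, Ch. I §2.2] -/
theorem intertwining_apply_smul {X Y : Type u} [AddCommGroup X] [TopologicalSpace X] [DiscreteTopology X]
    [AddCommGroup Y] [TopologicalSpace Y] [DiscreteTopology Y] {ρX : DiscreteGaloisModule F X}
    {ρY : DiscreteGaloisModule F Y} (a : ρX.toContRepresentation →ⁱL ρY.toContRepresentation)
    (g : Field.absoluteGaloisGroup F) (x : X) : a (ρX g x) = ρY g (a x) :=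
  congrArg (fun φ ↦ φ x) (a.isIntertwining' g)

variable (ι : ρ₁.toContRepresentation →ⁱL ρ₂.toContRepresentation)
  (r : ρ₂.toContRepresentation →ⁱL ρ₁.toContRepresentation)
  (j : ρN.toContRepresentation →ⁱL ρ₁.toContRepresentation)
  (q : ρ₁.toContRepresentation →ⁱL ρQ.toContRepresentation)
  (π : ρ₁.toContRepresentation →ⁱL ρN.toContRepresentation)
  (T₁ θ₁ : ρ₁.toContRepresentation →ⁱL ρ₁.toContRepresentation)
  (T₂ θ₂ : ρ₂.toContRepresentation →ⁱL ρ₂.toContRepresentation)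

/-! ## §2 The `θ₁`-torsion invariants of `W₁` are the `T₁ w'` with `q w'` invariant -/

/-- If `q w'` is invariant in `Q` then `T₁ w'` is invariant in `W₁` (`g w' − w' ∈ ker q = range j ⊆ ker T₁`) and is
killed by `θ₁` (`θ₁ ∘ T₁ = j ∘ π ∘ T₁ = 0`). [cite: Howard2004HeegnerKolyvagin, §2.2 (the levels W_j = E[p^j] ⊗ Λ/(T^m+p, p^j))] -/
theorem smul_mem_invariants_of_apply_mem (hjq : ∀ y, q y = 0 ↔ ∃ x, j x = y) (hTj : ∀ t, T₁ (j t) = 0)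
    (hjπ : ∀ x, j (π x) = θ₁ x) (hπT : ∀ x, π (T₁ x) = 0)
    (w' : M₁) (hw' : q w' ∈ ρQ.toTopRep.ρ.invariants) :
    T₁ w' ∈ ρ₁.toTopRep.ρ.invariants ∧ θ₁ (T₁ w') = 0 := by
  refine ⟨fun g ↦ ?_, by rw [← hjπ, hπT, map_zero]⟩
  change ρ₁ g (T₁ w') = T₁ w'
  have hker : q (ρ₁ g w' - w') = 0 := by
    rw [map_sub, intertwining_apply_smul q g w', sub_eq_zero]
    exact hw' g
  obtain ⟨t, ht⟩ := (hjq _).mp hker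
  rw [← sub_eq_zero, ← intertwining_apply_smul T₁ g w', ← map_sub, ← ht, hTj]

/-- Conversely an invariant `w` of `W₁` with `θ₁ w = 0` is `T₁ w'` with `q w'` invariant (`ker θ₁ ⊆ range T₁`;
`T₁ (g w' − w') = 0`, `ker T₁ ⊆ range j = ker q`). [cite: Howard2004HeegnerKolyvagin, §2.2 (the levels W_j = E[p^j] ⊗ Λ/(T^m+p, p^j))] -/
theorem exists_eq_smul_of_mem_invariants (hjq : ∀ y, q y = 0 ↔ ∃ x, j x = y)
    (hkerT : ∀ x, T₁ x = 0 → ∃ t, j t = x) (hkerθ : ∀ x, θ₁ x = 0 → ∃ w', T₁ w' = x)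
    (w : M₁) (hw : w ∈ ρ₁.toTopRep.ρ.invariants) (hθw : θ₁ w = 0) :
    ∃ w' : M₁, T₁ w' = w ∧ q w' ∈ ρQ.toTopRep.ρ.invariants := by
  obtain ⟨w', rfl⟩ := hkerθ w hθw
  refine ⟨w', rfl, fun g ↦ ?_⟩
  change ρQ g (q w') = q w'
  rw [← sub_eq_zero, ← intertwining_apply_smul q g w', ← map_sub]
  have h0 : T₁ (ρ₁ g w' - w') = 0 := by
    rw [map_sub, intertwining_apply_smul T₁ g w', sub_eq_zero]
    exact hw g
  obtain ⟨t, ht⟩ := hkerT _ h0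
  exact (hjq _).mpr ⟨t, ht⟩

/-! ## §3 The cocycle comparison -/

/-- **`H¹(π) (δ₀^Σ (T₁ w')) = − δ₀^Σ̄ (q w')`.**  For `w'` with `q w'` invariant in `Q`: lifting `T₁ w'` to `W₂` as
`w̃ = T₂ w̃'` (`r w̃' = w'`), the connecting cocycle of `Σ` is `g ↦ ι⁻¹(g w̃ − w̃) = ι⁻¹(T₂ (g w̃' − w̃'))`, and
`θ₂ ∘ T₂ = −ι ∘ r`, `ι ∘ θ₁ = θ₂ ∘ ι`, `j ∘ π = θ₁` give `j (π (ι⁻¹(g w̃ − w̃))) = −(g w' − w') = −j (j⁻¹(g w' − w'))`;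
both `ι` and `j` are injective. [cite: Howard2004HeegnerKolyvagin, §1.3 H.5(b) and §2.2 (arXiv:1202.6340 p. 7 L96–97)]
[cite: SerreGaloisCohomology1997, Ch. I §2.2 (cocycle of the connecting homomorphism)] [cite: NeukirchSchmidtWingberg2008, (1.3.2)] -/
theorem map_δ₀_smul_eq_neg_δ₀ (hι : Function.Injective ι) (hr : Function.Surjective r)
    (hιr : ∀ y, r y = 0 ↔ ∃ x, ι x = y) (hj : Function.Injective j) (hq : Function.Surjective q)
    (hjq : ∀ y, q y = 0 ↔ ∃ x, j x = y)
    (hrT : ∀ y, r (T₂ y) = T₁ (r y)) (hιθ : ∀ x, ι (θ₁ x) = θ₂ (ι x)) (hθT : ∀ y, θ₂ (T₂ y) = -ι (r y))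
    (hjπ : ∀ x, j (π x) = θ₁ x) (hTj : ∀ t, T₁ (j t) = 0) (hπT : ∀ x, π (T₁ x) = 0)
    (w' : M₁) (hw' : q w' ∈ ρQ.toTopRep.ρ.invariants) :
    galoisCohomology.map π 1
        ((isSES_ofHom ι r hι hr hιr).δ₀ ⟨T₁ w', (smul_mem_invariants_of_apply_mem j q π T₁ θ₁ hjq hTj hjπ hπT w' hw').1⟩) =
      -(isSES_ofHom j q hj hq hjq).δ₀ ⟨q w', hw'⟩ := by
  set S := isSES_ofHom ι r hι hr hιr with hS
  set S' := isSES_ofHom j q hj hq hjq with hS'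
  -- lifts: `w̃' ↦ w'` under `r`, `w̃ := T₂ w̃'` lifts `T₁ w'`; `w'` lifts `q w'`
  obtain ⟨wt', hwt'⟩ := hr w'
  have hlift : (TopRep.ofHom ⟨r.toContinuousLinearMap, r.isIntertwining'⟩ : ρ₂.toTopRep ⟶ ρ₁.toTopRep).hom (T₂ wt') =
      T₁ w' := by
    change r (T₂ wt') = T₁ w'
    rw [hrT, hwt']
  rw [S.δ₀_apply_eq _ (T₂ wt') hlift, S'.δ₀_apply_eq ⟨q w', hw'⟩ w' rfl,
    galoisCohomology.map_eq_cohomologyMap_apply, cohomologyMap_oneCocycleClass, ← oneCocycleClassₗ_apply,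
    ← oneCocycleClassₗ_apply, ← map_neg]
  congr 1
  refine Subtype.ext (ContinuousMap.ext fun g ↦ hj ?_)
  rw [pullback_id_resIdHom_apply]
  change j (π ((S.δ₀Cocycle (T₂ wt') _).1 g)) = j ((-(S'.δ₀Cocycle w' _)).1 g)
  -- right side: `j (−b_g) = −(g w' − w')`
  have hb : j ((S'.δ₀Cocycle w' (by rw [show (TopRep.ofHom ⟨q.toContinuousLinearMap, q.isIntertwining'⟩ :
      ρ₁.toTopRep ⟶ ρQ.toTopRep).hom w' = q w' from rfl]; exact hw')).1 g) = ρ₁ g w' - w' :=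
    S'.f_δ₀Cocycle_apply w' _ g
  have hneg : (-(S'.δ₀Cocycle w' (by rw [show (TopRep.ofHom ⟨q.toContinuousLinearMap, q.isIntertwining'⟩ :
      ρ₁.toTopRep ⟶ ρQ.toTopRep).hom w' = q w' from rfl]; exact hw'))).1 g =
      -((S'.δ₀Cocycle w' (by rw [show (TopRep.ofHom ⟨q.toContinuousLinearMap, q.isIntertwining'⟩ :
      ρ₁.toTopRep ⟶ ρQ.toTopRep).hom w' = q w' from rfl]; exact hw')).1 g) := rfl
  rw [hneg, map_neg, hb]
  -- left side: `j (π a_g) = θ₁ a_g`, and `ι (θ₁ a_g) = θ₂ (ι a_g) = θ₂ (T₂ (g w̃' − w̃')) = −ι (g w' − w')`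
  rw [hjπ]
  apply hι
  have ha : ι ((S.δ₀Cocycle (T₂ wt') (by rw [hlift]; exact
      (smul_mem_invariants_of_apply_mem j q π T₁ θ₁ hjq hTj hjπ hπT w' hw').1)).1 g) = ρ₂ g (T₂ wt') - T₂ wt' :=
    S.f_δ₀Cocycle_apply (T₂ wt') _ g
  rw [hιθ, ha, ← intertwining_apply_smul T₂ g wt', ← map_sub, hθT, map_sub, intertwining_apply_smul r g wt', hwt',
    map_neg]

/-! ## §4 The residual image of the `θ₁`-torsion connecting classes is the range of `δ₀^Σ̄` -/

/-- **The `H¹(π)`-image of `{δ₀^Σ w | w ∈ H⁰(F, W₁), θ₁ w = 0}` is the range of `δ₀^Σ̄` on `H⁰(F, Q)`.**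
[cite: Howard2004HeegnerKolyvagin, §1.3 H.5(b) (arXiv:1202.6340 p. 7 L96–97)] [cite: SerreGaloisCohomology1997, Ch. I §2.2] -/
theorem image_map_δ₀_eq_range_δ₀ (hι : Function.Injective ι) (hr : Function.Surjective r)
    (hιr : ∀ y, r y = 0 ↔ ∃ x, ι x = y) (hj : Function.Injective j) (hq : Function.Surjective q)
    (hjq : ∀ y, q y = 0 ↔ ∃ x, j x = y)
    (hrT : ∀ y, r (T₂ y) = T₁ (r y)) (hιθ : ∀ x, ι (θ₁ x) = θ₂ (ι x)) (hθT : ∀ y, θ₂ (T₂ y) = -ι (r y))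
    (hjπ : ∀ x, j (π x) = θ₁ x) (hTj : ∀ t, T₁ (j t) = 0) (hπT : ∀ x, π (T₁ x) = 0)
    (hkerT : ∀ x, T₁ x = 0 → ∃ t, j t = x) (hkerθ : ∀ x, θ₁ x = 0 → ∃ w', T₁ w' = x) :
    (galoisCohomology.map π 1) ''
        {y | ∃ w : ρ₁.toTopRep.ρ.invariants, θ₁ (w : M₁) = 0 ∧ (isSES_ofHom ι r hι hr hιr).δ₀ w = y} =
      Set.range fun q₀ : ρQ.toTopRep.ρ.invariants ↦ ((isSES_ofHom j q hj hq hjq).δ₀ q₀ : galoisCohomology ρN 1) := by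
  ext z
  constructor
  · rintro ⟨y, ⟨w, hθw, rfl⟩, rfl⟩
    obtain ⟨w', hw'w, hw'⟩ := exists_eq_smul_of_mem_invariants j q T₁ θ₁ hjq hkerT hkerθ w.1 w.2 hθw
    refine ⟨-⟨q w', hw'⟩, ?_⟩
    have hw : w = ⟨T₁ w', (smul_mem_invariants_of_apply_mem j q π T₁ θ₁ hjq hTj hjπ hπT w' hw').1⟩ :=
      Subtype.ext hw'w.symm
    rw [hw, map_δ₀_smul_eq_neg_δ₀ ι r j q π T₁ θ₁ T₂ θ₂ hι hr hιr hj hq hjq hrT hιθ hθT hjπ hTj hπT w' hw']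
    exact map_neg (isSES_ofHom j q hj hq hjq).δ₀ (⟨q w', hw'⟩ : ρQ.toTopRep.ρ.invariants)
  · rintro ⟨q₀, rfl⟩
    obtain ⟨w', hw'⟩ := hq (-q₀ : ρQ.toTopRep.ρ.invariants)
    have hw'i : q w' ∈ ρQ.toTopRep.ρ.invariants := by rw [hw']; exact (-q₀).2
    refine ⟨_, ⟨⟨T₁ w', (smul_mem_invariants_of_apply_mem j q π T₁ θ₁ hjq hTj hjπ hπT w' hw'i).1⟩,
      (smul_mem_invariants_of_apply_mem j q π T₁ θ₁ hjq hTj hjπ hπT w' hw'i).2, rfl⟩, ?_⟩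
    rw [map_δ₀_smul_eq_neg_δ₀ ι r j q π T₁ θ₁ T₂ θ₂ hι hr hιr hj hq hjq hrT hιθ hθT hjπ hTj hπT w' hw'i,
      show (⟨q w', hw'i⟩ : ρQ.toTopRep.ρ.invariants) = -q₀ from Subtype.ext hw', map_neg, neg_neg]


/-! ## §5 The `Q`-free form: the residual image is the KERNEL of `H¹(j)` (appended by x9-p1-w3 g5)

By exactness at `H¹(F, T̄)` the range of `δ₀^Σ̄` is `ker H¹(j)`; this kernel makes sense without naming the quotient `Q`,
and the comparison of §3 goes through with the row `Σ̄` replaced by the single INJECTIVE map `j` (hypotheses `hq`, `hjq`,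
`hkerT` dropped).  This is the shape consumed by the transport lemma `Howard2004/TransportConnectingKernelProofs`. -/

/-- **Core cocycle identity.** For `w'` with `T₁ w'` invariant and a lift `w̃'` of `w'` under `r`, the connecting cocycle
`a` of `Σ` at `T₁ w'` for the lift `T₂ w̃'` satisfies `θ₁ (a g) = −(g w' − w')` (apply the injective `ι`: `ι θ₁ a = θ₂ ι a =
θ₂ T₂ (g w̃' − w̃') = −ι r (g w̃' − w̃')`). [cite: Howard2004HeegnerKolyvagin, §1.3 H.5(b) and §2.2 (arXiv:1202.6340 p. 7 L96–97)]
[cite: SerreGaloisCohomology1997, Ch. I §2.2 (cocycle of the connecting homomorphism)] -/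
theorem apply_δ₀Cocycle_smul_eq (hι : Function.Injective ι) (hr : Function.Surjective r)
    (hιr : ∀ y, r y = 0 ↔ ∃ x, ι x = y)
    (hrT : ∀ y, r (T₂ y) = T₁ (r y)) (hιθ : ∀ x, ι (θ₁ x) = θ₂ (ι x)) (hθT : ∀ y, θ₂ (T₂ y) = -ι (r y))
    (w' : M₁) (hw : T₁ w' ∈ ρ₁.toTopRep.ρ.invariants) (wt' : M₂) (hwt' : r wt' = w')
    (g : Field.absoluteGaloisGroup F) :
    θ₁ (((isSES_ofHom ι r hι hr hιr).δ₀Cocycle (T₂ wt') (by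
        rw [show (TopRep.ofHom ⟨r.toContinuousLinearMap, r.isIntertwining'⟩ : ρ₂.toTopRep ⟶ ρ₁.toTopRep).hom (T₂ wt') =
          T₁ w' from (hrT wt').trans (by rw [hwt'])]; exact hw)).1 g) = -(ρ₁ g w' - w') := by
  set S := isSES_ofHom ι r hι hr hιr with hS
  apply hι
  have ha : ι ((S.δ₀Cocycle (T₂ wt') (by
      rw [show (TopRep.ofHom ⟨r.toContinuousLinearMap, r.isIntertwining'⟩ : ρ₂.toTopRep ⟶ ρ₁.toTopRep).hom (T₂ wt') =
        T₁ w' from (hrT wt').trans (by rw [hwt'])]; exact hw)).1 g) = ρ₂ g (T₂ wt') - T₂ wt' :=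
    S.f_δ₀Cocycle_apply (T₂ wt') _ g
  rw [hιθ, ha, ← intertwining_apply_smul T₂ g wt', ← map_sub, hθT, map_sub, intertwining_apply_smul r g wt', hwt',
    map_neg]

/-- **`Q`-free form of §4: the `H¹(π)`-image of `{δ₀^Σ w | w ∈ H⁰(F, W₁), θ₁ w = 0}` is `ker (H¹(j) : H¹(F, T̄) →
H¹(F, W₁))`** for an injective equivariant `j : T̄ → W₁` with `j ∘ π = θ₁`, `T₁ ∘ j = 0`, `π ∘ T₁ = 0`, `ker θ₁ ⊆ range
T₁` (and the `Σ`-identities `r ∘ T₂ = T₁ ∘ r`, `ι ∘ θ₁ = θ₂ ∘ ι`, `θ₂ ∘ T₂ = −ι ∘ r`).  `⊆`: `j (π a_g) = θ₁ a_g = −(g w' −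
w')` is principal; `⊇`: a class `[ζ]` with `j ζ_g = g m − m` is the `H¹(π)`-image of `δ₀^Σ (T₁ (−m))`.
[cite: Howard2004HeegnerKolyvagin, §1.3 H.5(b) (arXiv:1202.6340 p. 7 L96–97)] [cite: SerreGaloisCohomology1997, Ch. I §2.2] -/
theorem image_map_δ₀_eq_ker_map (hι : Function.Injective ι) (hr : Function.Surjective r)
    (hιr : ∀ y, r y = 0 ↔ ∃ x, ι x = y) (hj : Function.Injective j)
    (hrT : ∀ y, r (T₂ y) = T₁ (r y)) (hιθ : ∀ x, ι (θ₁ x) = θ₂ (ι x)) (hθT : ∀ y, θ₂ (T₂ y) = -ι (r y))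
    (hjπ : ∀ x, j (π x) = θ₁ x) (hTj : ∀ t, T₁ (j t) = 0) (hπT : ∀ x, π (T₁ x) = 0)
    (hkerθ : ∀ x, θ₁ x = 0 → ∃ w', T₁ w' = x) :
    (galoisCohomology.map π 1) ''
        {y | ∃ w : ρ₁.toTopRep.ρ.invariants, θ₁ (w : M₁) = 0 ∧ (isSES_ofHom ι r hι hr hιr).δ₀ w = y} =
      {z | galoisCohomology.map j 1 z = 0} := by
  set S := isSES_ofHom ι r hι hr hιr with hS
  -- the residual class of `δ₀^Σ (T₁ w')` is `[g ↦ π a_g]` with `j (π a_g) = −(g w' − w')`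
  have key : ∀ (w' : M₁) (hw : T₁ w' ∈ ρ₁.toTopRep.ρ.invariants),
      ∃ a : contOneCocycles ρN.toTopRep, galoisCohomology.map π 1 (S.δ₀ ⟨T₁ w', hw⟩) = oneCocycleClass _ a ∧
        ∀ g, j (a.1 g) = -(ρ₁ g w' - w') := by
    intro w' hw
    obtain ⟨wt', hwt'⟩ := hr w'
    have hlift : (TopRep.ofHom ⟨r.toContinuousLinearMap, r.isIntertwining'⟩ : ρ₂.toTopRep ⟶ ρ₁.toTopRep).hom (T₂ wt') =
        T₁ w' := (hrT wt').trans (by rw [hwt'])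
    refine ⟨contOneCocycles.pullback (ContinuousMonoidHom.id _)
        (resIdHom (TopRep.ofHom ⟨π.toContinuousLinearMap, π.isIntertwining'⟩ : ρ₁.toTopRep ⟶ ρN.toTopRep))
        (S.δ₀Cocycle (T₂ wt') (by rw [hlift]; exact hw)), ?_, fun g ↦ ?_⟩
    · rw [S.δ₀_apply_eq _ (T₂ wt') hlift, galoisCohomology.map_eq_cohomologyMap_apply]
      exact cohomologyMap_oneCocycleClass _ _
    · rw [pullback_id_resIdHom_apply]
      change j (π ((S.δ₀Cocycle (T₂ wt') _).1 g)) = _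
      rw [hjπ]
      exact apply_δ₀Cocycle_smul_eq ι r T₁ θ₁ T₂ θ₂ hι hr hιr hrT hιθ hθT w' hw wt' hwt' g
  ext z
  constructor
  · rintro ⟨y, ⟨w, hθw, rfl⟩, rfl⟩
    obtain ⟨w', hw'w⟩ := hkerθ w.1 hθw
    have hw' : T₁ w' ∈ ρ₁.toTopRep.ρ.invariants := by rw [hw'w]; exact w.2
    have hw : w = ⟨T₁ w', hw'⟩ := Subtype.ext hw'w.symm
    obtain ⟨a, ha, hja⟩ := key w' hw'
    change galoisCohomology.map j 1 (galoisCohomology.map π 1 (S.δ₀ w)) = 0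
    rw [hw, ha, galoisCohomology.map_oneCocycleClass_ofHom]
    refine (oneCocycleClass_eq_zero_iff _ _).mpr ⟨-w', fun g ↦ ?_⟩
    rw [contOneCocycles.pullback_apply]
    change j (a.1 g) = ρ₁ g (-w') - -w'
    rw [hja, map_neg]; abel
  · intro hz
    change galoisCohomology.map j 1 z = 0 at hz
    obtain ⟨ζ, rfl⟩ := oneCocycleClass_surjective _ z
    rw [galoisCohomology.map_oneCocycleClass_ofHom] at hz
    obtain ⟨m, hm⟩ := (oneCocycleClass_eq_zero_iff _ _).mp hz
    have hm' : ∀ g, j (ζ.1 g) = ρ₁ g m - m := fun g ↦ by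
      have h := hm g; rwa [contOneCocycles.pullback_apply] at h
    -- `w := T₁ (−m)` is invariant and `θ₁`-torsion
    have hw : T₁ (-m) ∈ ρ₁.toTopRep.ρ.invariants := fun g ↦ by
      change ρ₁ g (T₁ (-m)) = T₁ (-m)
      rw [map_neg T₁, map_neg (ρ₁ g), neg_inj, ← sub_eq_zero, ← intertwining_apply_smul T₁ g m, ← map_sub, ← hm',
        hTj]
    refine ⟨S.δ₀ ⟨T₁ (-m), hw⟩, ⟨⟨T₁ (-m), hw⟩, by rw [← hjπ, hπT, map_zero], rfl⟩, ?_⟩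
    obtain ⟨a, ha, hja⟩ := key (-m) hw
    rw [ha]
    congr 1
    refine Subtype.ext (ContinuousMap.ext fun g ↦ hj ?_)
    rw [hja, hm', map_neg]; abel

end DiscreteGaloisModule

end Literature.NumberTheory.GaloisRepresentations

end
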